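import Summits.NavierStokesRegularity.NavierStokesRegularity.Theorems.FilamentSkeletonRssKelvinGateDefs

/-!
# Route `FilamentSkeletonRss` · crux `TransverseReductionRJ` (stmt-NavierStokesRegularity-21221) — line `kelvin_gate`:
# the accretion modes `D_pj` of the crux are SMOOTH (the `x/0 := 0` junk in defining hypothesis 5 is invisible)

Helper file (theorems only, `--supports stmt-NavierStokesRegularity-21221 --as helper`), in the vocabulary of
`FilamentSkeletonRssKelvinGateDefs`.  HONEST FRAMING: bookkeeping for a HYPOTHETICAL filament-type RSS blow-up route;
nothing here bears on Navier–Stokes regularity; no stub is proved here.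

Defining hypothesis 5 of the crux (`DefD`) pins the accretion mode of tube `j` at parameter `p` to
`D_pj(y) = e^{−s²} · ((1 − e^{−q})/q) · (t × z)`, `z = y − X_pj(c_pj)`, `t = X′_pj(c_pj)`, `s = ⟨z, t⟩`,
`q = ‖z‖² − s²`, with Lean's `x / 0 = 0` at `q = 0`.  Since `t` is a UNIT vector (clause 3 of the box), `q = 0` exactly
on the axis `z ∥ t`, where `t × z = 0` as well; hence `D_pj` coincides EVERYWHERE with the field built from the entire
function `φ(q) = (1 − e^{−q})/q`, `φ(0) = 1` — in Lean, `φ = dslope (q ↦ 1 − e^{−q}) 0` — and is therefore smooth.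

* `analyticAt_dslope_one_sub_exp_neg`, `contDiff_dslope_one_sub_exp_neg` — `φ` is real-analytic, hence `C^∞`;
* `cross_eq_zero_of_norm_sq_sub_inner_sq_eq_zero` — `‖t‖ = 1 ∧ ‖z‖² − ⟨z,t⟩² = 0 ⇒ t × z = 0`;
* `accretionMode_eq_dslope_form` — the crux's formula equals the `dslope` form pointwise;
* `contDiff_accretionMode` — the crux's formula is `C^∞` for a unit tangent;
* `DefD.contDiff` — under `DefD` and `‖X′_pj(c_pj)‖ = 1` (clause 3 of `BoxClausesJ`), `D p j ∈ C^∞`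
  (so the differentiability hypothesis of `BaseSpec.lerayLin_rotField` is discharged, and stubs S1/S3/S4 may
  differentiate the modes freely).
-/

set_option linter.dupNamespace false

noncomputable section

namespace Summit.NavierStokesRegularity.NavierStokesRegularity.Theorems.KelvinGate

open Set Function
open Literature.Analysis.FluidPDE
open scoped InnerProductSpace Topology

/-! ## The profile `φ = dslope (q ↦ 1 − e^{−q}) 0` -/

/-- `q ↦ 1 − e^{−q}` is real-analytic. -/
theorem analyticAt_one_sub_exp_neg (q : ℝ) : AnalyticAt ℝ (fun q : ℝ => 1 - Real.exp (-q)) q :=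
  analyticAt_const.sub (analyticAt_rexp.comp analyticAt_id.neg)

/-- The profile `φ = dslope (q ↦ 1 − e^{−q}) 0` (`= (1 − e^{−q})/q` off `0`, `= 1` at `0`) is real-analytic
everywhere: at `0` by the power-series `dslope` lemma, elsewhere as a quotient of analytic functions. -/
theorem analyticAt_dslope_one_sub_exp_neg (q₀ : ℝ) :
    AnalyticAt ℝ (dslope (fun q : ℝ => 1 - Real.exp (-q)) 0) q₀ := by
  by_cases h : q₀ = 0
  · subst h
    obtain ⟨p, hp⟩ := analyticAt_one_sub_exp_neg 0
    exact hp.has_fpower_series_dslope_fslope.analyticAt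
  · have hslope : AnalyticAt ℝ (fun q : ℝ => (1 - Real.exp (-q) - (1 - Real.exp (-0))) / (q - 0)) q₀ :=
      ((analyticAt_one_sub_exp_neg q₀).sub analyticAt_const).div (analyticAt_id.sub analyticAt_const)
        (by simpa using h)
    refine hslope.congr ?_
    filter_upwards [(dslope_eventuallyEq_slope_of_ne (fun q : ℝ => 1 - Real.exp (-q)) h)] with q hq
    rw [hq, slope_def_field]

/-- The profile `φ` is `C^∞`. -/
theorem contDiff_dslope_one_sub_exp_neg {n : WithTop ℕ∞} :
    ContDiff ℝ n (dslope (fun q : ℝ => 1 - Real.exp (-q)) 0) :=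
  AnalyticOnNhd.contDiff fun q _ => analyticAt_dslope_one_sub_exp_neg q

/-- Off `q = 0` the crux's junk-division formula is the profile: `(1 − e^{−q})/q = φ(q)`. -/
theorem one_sub_exp_neg_div_eq_dslope {q : ℝ} (hq : q ≠ 0) :
    (1 - Real.exp (-q)) / q = dslope (fun q : ℝ => 1 - Real.exp (-q)) 0 q := by
  rw [dslope_of_ne _ hq, slope_def_field]
  simp

/-! ## Geometry of the axis -/

/-- For a UNIT vector `t`, `‖z‖² − ⟨z, t⟫² = 0` forces `z ∥ t`, hence `t × z = 0`. -/
theorem cross_eq_zero_of_norm_sq_sub_inner_sq_eq_zero {t z : EuclideanSpace ℝ (Fin 3)} (ht : ‖t‖ = 1)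
    (h : ‖z‖ ^ 2 - ⟪z, t⟫_ℝ ^ 2 = 0) : cross t z = 0 := by
  have hz : z = ⟪z, t⟫_ℝ • t := by
    have h0 : ‖z - ⟪z, t⟫_ℝ • t‖ ^ 2 = 0 := by
      rw [norm_sub_sq_real, inner_smul_right, norm_smul, Real.norm_eq_abs, ht, mul_one, sq_abs]
      nlinarith [h]
    have h1 : z - ⟪z, t⟫_ℝ • t = 0 := by
      have := pow_eq_zero_iff (n := 2) (by norm_num) |>.mp h0
      exact norm_eq_zero.mp this
    exact (sub_eq_zero.mp h1)
  rw [hz, ← crossCLM_apply, map_smul, crossCLM_apply]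
  have : cross t t = 0 := by
    simp only [cross, cross_self]; rfl
  rw [this, smul_zero]

/-! ## The accretion mode is smooth -/

/-- The crux's accretion-mode formula (with Lean's `x/0 = 0`) equals the `dslope` form at EVERY point, for a unit
tangent `t`: off the axis the scalar factors agree, on the axis both fields vanish because `t × z = 0`. -/
theorem accretionMode_eq_dslope_form (x₀ t : EuclideanSpace ℝ (Fin 3)) (ht : ‖t‖ = 1) :
    (fun y : EuclideanSpace ℝ (Fin 3) => (Real.exp (-(⟪y - x₀, t⟫_ℝ) ^ 2) *
        ((1 - Real.exp (-(‖y - x₀‖ ^ 2 - ⟪y - x₀, t⟫_ℝ ^ 2))) / (‖y - x₀‖ ^ 2 - ⟪y - x₀, t⟫_ℝ ^ 2))) •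
        cross t (y - x₀)) =
    fun y => (Real.exp (-(⟪y - x₀, t⟫_ℝ) ^ 2) *
        dslope (fun q : ℝ => 1 - Real.exp (-q)) 0 (‖y - x₀‖ ^ 2 - ⟪y - x₀, t⟫_ℝ ^ 2)) • cross t (y - x₀) := by
  funext y
  by_cases hq : ‖y - x₀‖ ^ 2 - ⟪y - x₀, t⟫_ℝ ^ 2 = 0
  · rw [cross_eq_zero_of_norm_sq_sub_inner_sq_eq_zero ht hq, smul_zero, smul_zero]
  · rw [one_sub_exp_neg_div_eq_dslope hq]

/-- **The accretion-mode formula is `C^∞`** for a unit tangent `t` (any base point `x₀`). -/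
theorem contDiff_accretionMode {n : WithTop ℕ∞} (x₀ t : EuclideanSpace ℝ (Fin 3)) (ht : ‖t‖ = 1) :
    ContDiff ℝ n (fun y : EuclideanSpace ℝ (Fin 3) => (Real.exp (-(⟪y - x₀, t⟫_ℝ) ^ 2) *
        ((1 - Real.exp (-(‖y - x₀‖ ^ 2 - ⟪y - x₀, t⟫_ℝ ^ 2))) / (‖y - x₀‖ ^ 2 - ⟪y - x₀, t⟫_ℝ ^ 2))) •
        cross t (y - x₀)) := by
  rw [accretionMode_eq_dslope_form x₀ t ht]
  have hs : ContDiff ℝ n (fun y : EuclideanSpace ℝ (Fin 3) => ⟪y - x₀, t⟫_ℝ) :=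
    (contDiff_id.sub contDiff_const).inner ℝ contDiff_const
  have hq : ContDiff ℝ n (fun y : EuclideanSpace ℝ (Fin 3) => ‖y - x₀‖ ^ 2 - ⟪y - x₀, t⟫_ℝ ^ 2) :=
    ((contDiff_norm_sq ℝ).comp (contDiff_id.sub contDiff_const)).sub (hs.pow 2)
  have hcross : ContDiff ℝ n (fun y : EuclideanSpace ℝ (Fin 3) => cross t (y - x₀)) := by
    have e : (fun y : EuclideanSpace ℝ (Fin 3) => cross t (y - x₀)) = fun y => crossCLM t (y - x₀) := by
      funext y; rw [crossCLM_apply]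
    rw [e]
    exact (crossCLM t).contDiff.comp (contDiff_id.sub contDiff_const)
  exact ((Real.contDiff_exp.comp (hs.pow 2).neg).mul (contDiff_dslope_one_sub_exp_neg.comp hq)).smul hcross

/-- **Under defining hypothesis 5 (`DefD`) the accretion mode `D p j` is `C^∞` whenever the tangent `X′_pj(c_pj)` is a
unit vector** (clause 3 of `BoxClausesJ` gives `‖X′_pj(τ)‖ = 1` for all `τ`). -/
theorem DefD.contDiff {N : ℕ} {X : (Fin N → ℝ) → Fin N → ℝ → EuclideanSpace ℝ (Fin 3)} {c : (Fin N → ℝ) → Fin N → ℝ}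
    {D : (Fin N → ℝ) → Fin N → EuclideanSpace ℝ (Fin 3) → EuclideanSpace ℝ (Fin 3)} (hD : DefD N X c D)
    {n : WithTop ℕ∞} (p : Fin N → ℝ) (j : Fin N) (hunit : ‖deriv (X p j) (c p j)‖ = 1) :
    ContDiff ℝ n (D p j) := by
  have e : D p j = fun y => (Real.exp (-(⟪y - X p j (c p j), deriv (X p j) (c p j)⟫_ℝ) ^ 2) *
      ((1 - Real.exp (-(‖y - X p j (c p j)‖ ^ 2 - ⟪y - X p j (c p j), deriv (X p j) (c p j)⟫_ℝ ^ 2))) /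
        (‖y - X p j (c p j)‖ ^ 2 - ⟪y - X p j (c p j), deriv (X p j) (c p j)⟫_ℝ ^ 2))) •
      cross (deriv (X p j) (c p j)) (y - X p j (c p j)) := funext fun y => hD p j y
  rw [e]
  exact contDiff_accretionMode (X p j (c p j)) (deriv (X p j) (c p j)) hunit

/-- The accretion modes of a box datum are differentiable everywhere (from `DefD.contDiff` and clause 3 of
`BoxClausesJ`): the form in which `BaseSpec.lerayLin_rotField` consumes them. -/
theorem BoxClausesJ.differentiable_accretionMode {N : ℕ} {Γ δ ρ K Λ a b cnd Rw Rb cg θ₀ : ℝ}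
    {γ : (Fin N → ℝ) → Fin N → ℝ} {α : (Fin N → ℝ) → ℝ} {X : (Fin N → ℝ) → Fin N → ℝ → EuclideanSpace ℝ (Fin 3)}
    {w : (Fin N → ℝ) → Fin N → ℝ → ℝ} {c : (Fin N → ℝ) → Fin N → ℝ} {m n' : (Fin N → ℝ) → Fin N → EuclideanSpace ℝ (Fin 3)}
    {v : (Fin N → ℝ) → EuclideanSpace ℝ (Fin 3) → EuclideanSpace ℝ (Fin 3)}
    {A : (Fin N → ℝ) → Fin N → (EuclideanSpace ℝ (Fin 3) →L[ℝ] EuclideanSpace ℝ (Fin 3))}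
    {T : (Fin N → ℝ) → (Fin N → ℝ → EuclideanSpace ℝ (Fin 3)) → Fin N → ℝ → EuclideanSpace ℝ (Fin 3)}
    {D : (Fin N → ℝ) → Fin N → EuclideanSpace ℝ (Fin 3) → EuclideanSpace ℝ (Fin 3)}
    (hD : DefD N X c D) (hbox : BoxClausesJ N Γ δ ρ K Λ a b cnd Rw Rb cg θ₀ γ α X w c m n' v A T)
    {p : Fin N → ℝ} (hp : ∀ i, p i ∈ Icc (0:ℝ) 1) (j : Fin N) : Differentiable ℝ (D p j) := by
  have hunit : ‖deriv (X p j) (c p j)‖ = 1 := ((hbox.2 p hp).2.2.1 j).2.2.1 (c p j)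
  exact (hD.contDiff (n := 1) p j hunit).differentiable (by norm_num)

end Summit.NavierStokesRegularity.NavierStokesRegularity.Theorems.KelvinGate
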